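import Mathlib.Analysis.SpecialFunctions.Pow.Real
import Literature.Analysis.ValidatedNumerics.BoxCover
import Literature.Analysis.ValidatedNumerics.KernelData
import HarnessLib

/-!
# Rational interval extensions of `|·|`, `x²`, `x⁻¹`, `√x`, `min`, `max`, and the term language `RExpr`

Topic `Literature/Analysis/ValidatedNumerics`. `IntervalEnclosure.lean` provides exact rational
interval `+`, `−`, Moore `×`, powers and outward rounding; `Certificate.lean`/`BoxCover.lean` the
polynomial term language `ArithExpr` with its kd-tree bound verifier. This file adds the rational
interval extensions a window certificate typically needs beyond polynomials — absolute value,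
square (tight, unlike `x ·ₘ x`), reciprocal of an interval not containing `0`, square root
(dyadically rounded Heron bounds), `min`, `max` — each with its inclusion theorem, and the term
language `RExpr` containing them, with a PARTIAL natural interval extension `RExpr.enclose`
(`none` when a reciprocal of an interval containing `0` is requested), its inclusion theorem
`RExpr.eval_mem_enclose`, and the kd-tree leaf check `rexprLeOn` / verifier `kdRBoundVerifier`
for claims "`e ≤ b` on a box" (`RBoxBoundClaim`, cf. `kdBoundVerifier`). Everything is exact
rational arithmetic: certificates are checked by `decide` / `decide +kernel` / `native_decide`.

## Main definitions

* `NonemptyInterval.absI`, `sqI`, `invI?`, `minI`, `maxI` (deliberate dot-notation extensions of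
  Mathlib's `NonemptyInterval`, as in `IntervalEnclosure.lean`), with `abs_mem_absI`, `sq_mem_sqI`,
  `inv_mem_of_invI?`, `min_mem_minI`, `max_mem_maxI`;
* `sqrtUp prec k q` (`≥ √q`), `sqrtDown prec k q` (`≤ √q`): `k` Heron steps from `max q 1`, each
  rounded outward to the dyadic grid `2^{-prec}ℤ`; `NonemptyInterval.sqrtI`, `sqrt_mem_sqrtI`;
* `RExpr`, `RExpr.eval` (`x⁻¹` with Mathlib's `0⁻¹ = 0`, `Real.sqrt` with `√(negative) = 0`),
  `RExpr.enclose prec iters X`, **`RExpr.eval_mem_enclose`**;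
* `rexprLeOn`, `reval_le_of_kdCheck`, `RBoxBoundClaim`, `kdRBoundVerifier`; a kernel example.

## References

* R. E. Moore, *Interval Analysis*, Prentice-Hall (1966), Ch. 3 (united/natural interval
  extensions of rational functions, inclusion property), §4.4 (subdivision). [cite: Moore1966, Ch. 3]
-/

open Set

/-! ### Interval extensions of elementary operations -/

namespace NonemptyInterval

variable {x y : ℝ} {I J : NonemptyInterval ℚ}

/-- Interval extension of `|·|`: `[a, b] ↦ [max 0 (max a (−b)), max (−a) b]` (dot-notation extension of
Mathlib's `NonemptyInterval`). [cite: Moore1966, Ch. 3] -/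
def absI (I : NonemptyInterval ℚ) : NonemptyInterval ℚ where
  fst := max 0 (max I.fst (-I.snd))
  snd := max (-I.fst) I.snd
  fst_le_snd := by
    have h := I.fst_le_snd
    refine max_le ?_ (max_le (le_max_of_le_right h) (le_max_of_le_left (neg_le_neg h)))
    rcases le_or_gt 0 I.snd with hb | hb
    · exact le_max_of_le_right hb
    · exact le_max_of_le_left (by linarith)

/-- Inclusion property of `absI`. [cite: Moore1966, Theorem 3.1] -/
theorem abs_mem_absI (hx : x ∈ I.ratCast ℝ) : |x| ∈ I.absI.ratCast ℝ := by
  rw [mem_ratCast_iff] at hx ⊢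
  obtain ⟨h1, h2⟩ := hx
  simp only [absI, Rat.cast_max, Rat.cast_zero, Rat.cast_neg]
  constructor
  · exact max_le (abs_nonneg x) (max_le (h1.trans (le_abs_self x)) (le_trans (by linarith) (neg_le_abs x)))
  · rcases le_or_gt 0 x with h | h
    · rw [abs_of_nonneg h]; exact le_max_of_le_right h2
    · rw [abs_of_neg h]; exact le_max_of_le_left (by linarith)

/-- Interval extension of `x ↦ x²`: `[0, max a² b²]` if `0 ∈ [a, b]`, else `[min a² b², max a² b²]`
(tight, unlike the Moore product `[a,b] ·ₘ [a,b]`). [cite: Moore1966, Ch. 3] -/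
def sqI (I : NonemptyInterval ℚ) : NonemptyInterval ℚ where
  fst := if I.fst ≤ 0 ∧ 0 ≤ I.snd then 0 else min (I.fst ^ 2) (I.snd ^ 2)
  snd := max (I.fst ^ 2) (I.snd ^ 2)
  fst_le_snd := by
    split_ifs
    · exact le_max_of_le_left (sq_nonneg _)
    · exact min_le_max

/-- Inclusion property of `sqI`. [cite: Moore1966, Theorem 3.1] -/
theorem sq_mem_sqI (hx : x ∈ I.ratCast ℝ) : x ^ 2 ∈ I.sqI.ratCast ℝ := by
  rw [mem_ratCast_iff] at hx ⊢
  obtain ⟨h1, h2⟩ := hx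
  have hup : x ^ 2 ≤ ((max (I.fst ^ 2) (I.snd ^ 2) : ℚ) : ℝ) := by
    push_cast
    rcases le_or_gt 0 x with h | h
    · exact le_max_of_le_right (by nlinarith)
    · exact le_max_of_le_left (by nlinarith)
  refine ⟨?_, hup⟩
  simp only [sqI]
  split_ifs with h0
  · push_cast; exact sq_nonneg x
  · push_cast
    rcases not_and_or.1 h0 with ha | hb
    · rw [not_le] at ha
      have ha' : (0 : ℝ) < I.fst := by exact_mod_cast ha
      exact min_le_of_left_le (by nlinarith)
    · rw [not_le] at hb
      have hb' : (I.snd : ℝ) < 0 := by exact_mod_cast hb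
      exact min_le_of_right_le (by nlinarith)

/-- Interval extension of `x ↦ x⁻¹` on intervals not containing `0`: `[a, b] ↦ [b⁻¹, a⁻¹]`; `none` if
`a ≤ 0 ≤ b`. [cite: Moore1966, Ch. 3] -/
def invI? (I : NonemptyInterval ℚ) : Option (NonemptyInterval ℚ) :=
  if h : 0 < I.fst then some ⟨(I.snd⁻¹, I.fst⁻¹), inv_anti₀ h I.fst_le_snd⟩
  else if h' : I.snd < 0 then
    some ⟨(I.snd⁻¹, I.fst⁻¹), (inv_le_inv_of_neg h' (lt_of_le_of_lt I.fst_le_snd h')).2 I.fst_le_snd⟩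
  else none

/-- Inclusion property of `invI?`. [cite: Moore1966, Theorem 3.1] -/
theorem inv_mem_of_invI? (hx : x ∈ I.ratCast ℝ) {J : NonemptyInterval ℚ} (hJ : I.invI? = some J) :
    x⁻¹ ∈ J.ratCast ℝ := by
  rw [mem_ratCast_iff] at hx
  obtain ⟨h1, h2⟩ := hx
  unfold invI? at hJ
  split_ifs at hJ with ha hb
  · simp only [Option.some.injEq] at hJ
    subst hJ
    rw [mem_ratCast_iff]
    have ha' : (0 : ℝ) < I.fst := by exact_mod_cast ha
    have hx0 : 0 < x := ha'.trans_le h1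
    simp only [Rat.cast_inv]
    exact ⟨inv_anti₀ hx0 h2, inv_anti₀ ha' h1⟩
  · simp only [Option.some.injEq] at hJ
    subst hJ
    rw [mem_ratCast_iff]
    have hb' : (I.snd : ℝ) < 0 := by exact_mod_cast hb
    have hx0 : x < 0 := lt_of_le_of_lt h2 hb'
    have ha0 : (I.fst : ℝ) < 0 := lt_of_le_of_lt h1 hx0
    simp only [Rat.cast_inv]
    exact ⟨(inv_le_inv_of_neg hb' hx0).2 h2, (inv_le_inv_of_neg hx0 ha0).2 h1⟩

/-- Interval extension of `min` (exact). [cite: Moore1966, Ch. 3] -/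
def minI (I J : NonemptyInterval ℚ) : NonemptyInterval ℚ :=
  ⟨(min I.fst J.fst, min I.snd J.snd), min_le_min I.fst_le_snd J.fst_le_snd⟩

/-- Interval extension of `max` (exact). [cite: Moore1966, Ch. 3] -/
def maxI (I J : NonemptyInterval ℚ) : NonemptyInterval ℚ :=
  ⟨(max I.fst J.fst, max I.snd J.snd), max_le_max I.fst_le_snd J.fst_le_snd⟩

/-- Inclusion property of `minI`. [cite: Moore1966, Theorem 3.1] -/
theorem min_mem_minI (hx : x ∈ I.ratCast ℝ) (hy : y ∈ J.ratCast ℝ) : min x y ∈ (I.minI J).ratCast ℝ := by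
  rw [mem_ratCast_iff] at hx hy ⊢
  simp only [minI, Rat.cast_min]
  exact ⟨min_le_min hx.1 hy.1, min_le_min hx.2 hy.2⟩

/-- Inclusion property of `maxI`. [cite: Moore1966, Theorem 3.1] -/
theorem max_mem_maxI (hx : x ∈ I.ratCast ℝ) (hy : y ∈ J.ratCast ℝ) : max x y ∈ (I.maxI J).ratCast ℝ := by
  rw [mem_ratCast_iff] at hx hy ⊢
  simp only [maxI, Rat.cast_max]
  exact ⟨max_le_max hx.1 hy.1, max_le_max hx.2 hy.2⟩

end NonemptyInterval

/-! ### Rational square-root bounds (Heron, dyadically rounded) -/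

namespace Literature.Analysis.ValidatedNumerics

open NonemptyInterval

/-- Upper Heron bound of `√q`: `k` steps `s ↦ ⌈(s + q/s)/2⌉_{2^{-prec}}` from `max q 1`. [folklore] -/
def sqrtUp (prec : ℕ) : ℕ → ℚ → ℚ
  | 0, q => max q 1
  | k + 1, q => dyCeil prec ((sqrtUp prec k q + q / sqrtUp prec k q) / 2)

/-- Lower bound of `√q`: `⌊q / sqrtUp⌋_{2^{-prec}}`, clipped below at `0`. [folklore] -/
def sqrtDown (prec k : ℕ) (q : ℚ) : ℚ := max 0 (dyFloor prec (q / sqrtUp prec k q))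

/-- `sqrtUp` is positive and its square dominates `q`, for `q ≥ 0`. [folklore] -/
theorem sqrtUp_pos_and_le_sq (prec : ℕ) {q : ℚ} (hq : 0 ≤ q) :
    ∀ k, 0 < sqrtUp prec k q ∧ q ≤ sqrtUp prec k q ^ 2
  | 0 => by
    refine ⟨lt_of_lt_of_le one_pos (le_max_right _ _), ?_⟩
    have h1 : (1 : ℚ) ≤ max q 1 := le_max_right _ _
    have h2 : q ≤ max q 1 := le_max_left _ _
    show q ≤ max q 1 ^ 2
    nlinarith
  | k + 1 => by
    obtain ⟨hs, hsq⟩ := sqrtUp_pos_and_le_sq prec hq k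
    set s := sqrtUp prec k q with hs_def
    have hm : 0 < (s + q / s) / 2 := by positivity
    have hle : (s + q / s) / 2 ≤ sqrtUp prec (k + 1) q := le_dyCeil prec _
    refine ⟨hm.trans_le hle, ?_⟩
    have key : q ≤ ((s + q / s) / 2) ^ 2 := by
      have e : ((s + q / s) / 2) ^ 2 - q = ((s - q / s) / 2) ^ 2 := by
        field_simp
        ring
      nlinarith [sq_nonneg ((s - q / s) / 2)]
    exact key.trans (pow_le_pow_left₀ hm.le hle 2)

/-- `√x ≤ sqrtUp prec k q` whenever `x ≤ q`. [folklore] -/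
theorem sqrt_le_sqrtUp (prec k : ℕ) {q : ℚ} {x : ℝ} (hq : 0 ≤ q) (hx : x ≤ q) :
    Real.sqrt x ≤ (sqrtUp prec k q : ℝ) := by
  obtain ⟨hs, hsq⟩ := sqrtUp_pos_and_le_sq prec hq k
  have hs' : (0 : ℝ) ≤ sqrtUp prec k q := by exact_mod_cast hs.le
  have hsq' : (q : ℝ) ≤ (sqrtUp prec k q : ℝ) ^ 2 := by exact_mod_cast hsq
  calc Real.sqrt x ≤ Real.sqrt ((sqrtUp prec k q : ℝ) ^ 2) := Real.sqrt_le_sqrt (hx.trans hsq')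
    _ = sqrtUp prec k q := Real.sqrt_sq hs'

/-- `sqrtDown prec k q ≤ √x` whenever `0 ≤ q ≤ x`. [folklore] -/
theorem sqrtDown_le_sqrt (prec k : ℕ) {q : ℚ} {x : ℝ} (hq : 0 ≤ q) (hx : (q : ℝ) ≤ x) :
    (sqrtDown prec k q : ℝ) ≤ Real.sqrt x := by
  obtain ⟨hs, hsq⟩ := sqrtUp_pos_and_le_sq prec hq k
  unfold sqrtDown
  push_cast
  refine max_le (Real.sqrt_nonneg _) ?_
  have h1 : ((dyFloor prec (q / sqrtUp prec k q) : ℚ) : ℝ) ≤ ((q / sqrtUp prec k q : ℚ) : ℝ) := by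
    exact_mod_cast dyFloor_le prec _
  refine h1.trans ?_
  push_cast
  have hs' : (0 : ℝ) < sqrtUp prec k q := by exact_mod_cast hs
  have hroot : Real.sqrt q ≤ sqrtUp prec k q := sqrt_le_sqrtUp prec k hq le_rfl
  rw [div_le_iff₀ hs']
  calc (q : ℝ) = Real.sqrt q * Real.sqrt q := (Real.mul_self_sqrt (by exact_mod_cast hq)).symm
    _ ≤ Real.sqrt x * sqrtUp prec k q :=
        mul_le_mul (Real.sqrt_le_sqrt hx) hroot (Real.sqrt_nonneg _) (Real.sqrt_nonneg _)

/-- `sqrtDown` is below `sqrtUp` of a larger argument (both arguments `≥ 0`). [folklore] -/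
theorem sqrtDown_le_sqrtUp (prec k : ℕ) {p q : ℚ} (hp : 0 ≤ p) (hpq : p ≤ q) :
    sqrtDown prec k p ≤ sqrtUp prec k q := by
  have h1 := sqrtDown_le_sqrt prec k hp (le_refl (p : ℝ))
  have h2 := sqrt_le_sqrtUp prec k (hp.trans hpq) (show (p : ℝ) ≤ q by exact_mod_cast hpq)
  exact_mod_cast h1.trans h2

end Literature.Analysis.ValidatedNumerics

namespace NonemptyInterval

open Literature.Analysis.ValidatedNumerics

variable {x : ℝ} {I : NonemptyInterval ℚ}

/-- Interval extension of `√·` (with `√(negative) = 0`):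
`[a, b] ↦ [sqrtDown (max a 0), sqrtUp (max b 0)]`. [cite: Moore1966, Ch. 3] -/
def sqrtI (prec k : ℕ) (I : NonemptyInterval ℚ) : NonemptyInterval ℚ :=
  ⟨(sqrtDown prec k (max I.fst 0), sqrtUp prec k (max I.snd 0)),
    sqrtDown_le_sqrtUp prec k (le_max_right _ _) (max_le_max I.fst_le_snd le_rfl)⟩

/-- Inclusion property of `sqrtI`. [cite: Moore1966, Theorem 3.1] -/
theorem sqrt_mem_sqrtI (prec k : ℕ) (hx : x ∈ I.ratCast ℝ) : Real.sqrt x ∈ (I.sqrtI prec k).ratCast ℝ := by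
  rw [mem_ratCast_iff] at hx ⊢
  obtain ⟨h1, h2⟩ := hx
  constructor
  · show ((sqrtDown prec k (max I.fst 0) : ℚ) : ℝ) ≤ Real.sqrt x
    rcases le_or_gt 0 x with h0 | h0
    · exact sqrtDown_le_sqrt prec k (le_max_right _ _)
        (by push_cast; exact max_le h1 h0)
    · have ha : max I.fst 0 = 0 := max_eq_right (by exact_mod_cast (h1.trans h0.le))
      rw [ha]
      have : sqrtDown prec k 0 = 0 := by simp [sqrtDown, dyFloor]
      rw [this, Rat.cast_zero]
      exact Real.sqrt_nonneg _
  · show Real.sqrt x ≤ ((sqrtUp prec k (max I.snd 0) : ℚ) : ℝ)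
    exact sqrt_le_sqrtUp prec k (le_max_right _ _) (by push_cast; exact le_max_of_le_left h2)

end NonemptyInterval

/-! ### The term language `RExpr` -/

namespace Literature.Analysis.ValidatedNumerics

open NonemptyInterval

/-- Terms `q | xᵢ | e₁ + e₂ | e₁ − e₂ | e₁ · e₂ | −e | e² | e⁻¹ | |e| | √e | min e₁ e₂ | max e₁ e₂` in
countably many real variables with rational constants. [folklore] -/
inductive RExpr : Type
  /-- rational constant -/
  | const (q : ℚ) : RExpr
  /-- the `i`-th variable -/
  | var (i : ℕ) : RExpr
  /-- sum -/
  | add (e₁ e₂ : RExpr) : RExpr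
  /-- difference -/
  | sub (e₁ e₂ : RExpr) : RExpr
  /-- product -/
  | mul (e₁ e₂ : RExpr) : RExpr
  /-- negation -/
  | neg (e : RExpr) : RExpr
  /-- square -/
  | sq (e : RExpr) : RExpr
  /-- reciprocal -/
  | inv (e : RExpr) : RExpr
  /-- absolute value -/
  | abs (e : RExpr) : RExpr
  /-- square root -/
  | sqrt (e : RExpr) : RExpr
  /-- minimum -/
  | min (e₁ e₂ : RExpr) : RExpr
  /-- maximum -/
  | max (e₁ e₂ : RExpr) : RExpr
  deriving DecidableEq, Inhabited

/-- Combine two optional results. [folklore] -/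
def obind₂ {α β : Type*} (oa ob : Option α) (f : α → α → β) : Option β :=
  match oa, ob with
  | some A, some B => some (f A B)
  | _, _ => none

/-- `obind₂` returns `some` iff both arguments do. [folklore] -/
theorem obind₂_eq_some_iff {α β : Type*} {oa ob : Option α} {f : α → α → β} {c : β} :
    obind₂ oa ob f = some c ↔ ∃ A B, oa = some A ∧ ob = some B ∧ f A B = c := by
  cases oa <;> cases ob <;> simp [obind₂]

namespace RExpr

/-- The real number denoted by a term at the point `x` (`⁻¹` and `√` with Mathlib's junk values
`0⁻¹ = 0`, `√(negative) = 0`). [cite: Moore1966, §3.1] -/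
noncomputable def eval (x : ℕ → ℝ) : RExpr → ℝ
  | const q => q
  | var i => x i
  | add e₁ e₂ => e₁.eval x + e₂.eval x
  | sub e₁ e₂ => e₁.eval x - e₂.eval x
  | mul e₁ e₂ => e₁.eval x * e₂.eval x
  | neg e => -e.eval x
  | sq e => e.eval x ^ 2
  | inv e => (e.eval x)⁻¹
  | abs e => |e.eval x|
  | sqrt e => Real.sqrt (e.eval x)
  | min e₁ e₂ => Min.min (e₁.eval x) (e₂.eval x)
  | max e₁ e₂ => Max.max (e₁.eval x) (e₂.eval x)

/-- The **natural interval extension** of a term on the box `X` at working precision `prec` (dyadic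
outward rounding after each arithmetic node; `iters` Heron steps for square roots); `none` if a
reciprocal of an interval containing `0` occurs. Computable, kernel-reducible. [cite: Moore1966, §3.1–3.2] -/
def enclose (prec iters : ℕ) (X : ℕ → NonemptyInterval ℚ) : RExpr → Option (NonemptyInterval ℚ)
  | const q => some (pure q)
  | var i => some (X i)
  | add e₁ e₂ => obind₂ (e₁.enclose prec iters X) (e₂.enclose prec iters X) fun A B ↦ (A + B).roundOut prec
  | sub e₁ e₂ => obind₂ (e₁.enclose prec iters X) (e₂.enclose prec iters X) fun A B ↦ (A - B).roundOut prec
  | mul e₁ e₂ =>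
      obind₂ (e₁.enclose prec iters X) (e₂.enclose prec iters X) fun A B ↦ (A.mooreMul B).roundOut prec
  | neg e => (e.enclose prec iters X).map fun A ↦ -A
  | sq e => (e.enclose prec iters X).map fun A ↦ A.sqI.roundOut prec
  | inv e => (e.enclose prec iters X).bind fun A ↦ A.invI?.map fun B ↦ B.roundOut prec
  | abs e => (e.enclose prec iters X).map fun A ↦ A.absI
  | sqrt e => (e.enclose prec iters X).map fun A ↦ A.sqrtI prec iters
  | min e₁ e₂ => obind₂ (e₁.enclose prec iters X) (e₂.enclose prec iters X) fun A B ↦ A.minI B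
  | max e₁ e₂ => obind₂ (e₁.enclose prec iters X) (e₂.enclose prec iters X) fun A B ↦ A.maxI B

/-- **Inclusion property** of the natural interval extension of `RExpr`: if every coordinate `x i`
lies in `X i` and the extension of `e` returns `some I`, then the value of `e` at `x` lies in `I`
(Moore 1966, Theorem 3.1). [cite: Moore1966, Theorem 3.1] -/
theorem eval_mem_enclose {prec iters : ℕ} {X : ℕ → NonemptyInterval ℚ} {x : ℕ → ℝ}
    (hx : ∀ i, x i ∈ (X i).ratCast ℝ) :
    ∀ (e : RExpr) {I : NonemptyInterval ℚ}, e.enclose prec iters X = some I → e.eval x ∈ I.ratCast ℝ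
  | const q, I, h => by
    simp only [enclose, Option.some.injEq] at h
    subst h
    rw [ratCast_pure]
    exact mem_pure_self _
  | var i, I, h => by
    simp only [enclose, Option.some.injEq] at h
    subst h
    exact hx i
  | add e₁ e₂, I, h => by
    obtain ⟨A, B, hA, hB, rfl⟩ := obind₂_eq_some_iff.1 h
    exact mem_roundOut prec (isSoundFun₂_add (eval_mem_enclose hx e₁ hA) (eval_mem_enclose hx e₂ hB))
  | sub e₁ e₂, I, h => by
    obtain ⟨A, B, hA, hB, rfl⟩ := obind₂_eq_some_iff.1 h
    exact mem_roundOut prec (isSoundFun₂_sub (eval_mem_enclose hx e₁ hA) (eval_mem_enclose hx e₂ hB))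
  | mul e₁ e₂, I, h => by
    obtain ⟨A, B, hA, hB, rfl⟩ := obind₂_eq_some_iff.1 h
    exact mem_roundOut prec
      (isSoundFun₂_mooreMul (eval_mem_enclose hx e₁ hA) (eval_mem_enclose hx e₂ hB))
  | neg e, I, h => by
    obtain ⟨A, hA, rfl⟩ := Option.map_eq_some_iff.1 h
    exact isSoundFun_neg (eval_mem_enclose hx e hA)
  | sq e, I, h => by
    obtain ⟨A, hA, rfl⟩ := Option.map_eq_some_iff.1 h
    exact mem_roundOut prec (sq_mem_sqI (eval_mem_enclose hx e hA))
  | inv e, I, h => by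
    obtain ⟨A, hA, h2⟩ := Option.bind_eq_some_iff.1 h
    obtain ⟨B, hB, rfl⟩ := Option.map_eq_some_iff.1 h2
    exact mem_roundOut prec (inv_mem_of_invI? (eval_mem_enclose hx e hA) hB)
  | abs e, I, h => by
    obtain ⟨A, hA, rfl⟩ := Option.map_eq_some_iff.1 h
    exact abs_mem_absI (eval_mem_enclose hx e hA)
  | sqrt e, I, h => by
    obtain ⟨A, hA, rfl⟩ := Option.map_eq_some_iff.1 h
    exact sqrt_mem_sqrtI prec iters (eval_mem_enclose hx e hA)
  | min e₁ e₂, I, h => by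
    obtain ⟨A, B, hA, hB, rfl⟩ := obind₂_eq_some_iff.1 h
    exact min_mem_minI (eval_mem_enclose hx e₁ hA) (eval_mem_enclose hx e₂ hB)
  | max e₁ e₂, I, h => by
    obtain ⟨A, B, hA, hB, rfl⟩ := obind₂_eq_some_iff.1 h
    exact max_mem_maxI (eval_mem_enclose hx e₁ hA) (eval_mem_enclose hx e₂ hB)

end RExpr

/-! ### Box claims `e ≤ b` for `RExpr`, by kd-tree subdivision -/

/-- Leaf check "`e ≤ b` on the box `B`" for `RExpr`: the extension at precision `pi.1` with `pi.2`
Heron steps returns an interval whose right end is `≤ b`. [cite: Moore1966, Theorem 3.1] -/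
def rexprLeOn (e : RExpr) (b : ℚ) (B : Box) (pi : ℕ × ℕ) : Bool :=
  match e.enclose pi.1 pi.2 B.toIvl with
  | some I => decide (I.snd ≤ b)
  | none => false

/-- **Soundness of the leaf check.** [cite: Moore1966, Theorem 3.1] -/
theorem rexprLeOn_sound {e : RExpr} {b : ℚ} {B : Box} {pi : ℕ × ℕ} (h : rexprLeOn e b B pi = true)
    (x : ℕ → ℝ) (hx : B.mem x) : e.eval x ≤ b := by
  unfold rexprLeOn at h
  split at h
  · rename_i I hI
    have hm := RExpr.eval_mem_enclose (fun i ↦ Box.mem_toIvl hx i) e hI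
    exact (mem_ratCast_iff.1 hm).2.trans (Rat.cast_le.2 (of_decide_eq_true h))
  · exact absurd h Bool.false_ne_true

/-- **`e ≤ b` on a box from a kd-tree of (precision, Heron steps) leaves.** [cite: Moore1966, Theorem 3.1, §4.4] -/
theorem reval_le_of_kdCheck {e : RExpr} {b : ℚ} {B : Box} {t : KdCert (ℕ × ℕ)}
    (h : t.check (rexprLeOn e b) B = true) (x : ℕ → ℝ) (hx : B.mem x) : e.eval x ≤ b :=
  KdCert.sound (fun _ _ hl x hx ↦ rexprLeOn_sound hl x hx) t B h x hx

/-- A **box bound claim** for `RExpr`: `expr ≤ bound` at every real point of the box. [folklore] -/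
structure RBoxBoundClaim where
  /-- the term to be bounded -/
  expr : RExpr
  /-- the box -/
  box : Box
  /-- the claimed upper bound -/
  bound : ℚ

/-- The proposition asserted by an `RBoxBoundClaim`. [folklore] -/
def RBoxBoundClaim.Holds (c : RBoxBoundClaim) : Prop :=
  ∀ x : ℕ → ℝ, c.box.mem x → c.expr.eval x ≤ c.bound

/-- **The subdividing bound verifier for `RExpr`** (certificates: kd-trees of leaves
`(precision, Heron steps)`). [cite: Moore1966, Theorem 3.1, §4.4] -/
def kdRBoundVerifier : Verifier RBoxBoundClaim RBoxBoundClaim.Holds where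
  Cert := KdCert (ℕ × ℕ)
  check c t := t.check (rexprLeOn c.expr c.bound) c.box
  sound _ _ h x hx := reval_le_of_kdCheck h x hx

/-- The checker of `kdRBoundVerifier`, unfolded. [folklore] -/
@[simp] theorem kdRBoundVerifier_check (c : RBoxBoundClaim) (t : KdCert (ℕ × ℕ)) :
    kdRBoundVerifier.check c t = t.check (rexprLeOn c.expr c.bound) c.box := rfl

/-- **Soundness of `kdRBoundVerifier`** in the statement shape of `Certificate.lean`. [cite: Moore1966, Theorem 3.1] -/
theorem RBoxBoundClaim.holds_of_check (c : RBoxBoundClaim) (t : KdCert (ℕ × ℕ))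
    (h : kdRBoundVerifier.check c t = true) : c.Holds :=
  kdRBoundVerifier.claim t h

/-- Kernel example: `1/x + √x ≤ 51/20` for `x ∈ [1, 4]` (true maximum `9/4` at `x = 4`). On the whole
box the extension is `[1/4, 1] + [1, 2⁺] ∌ ≤ 51/20`; after one bisection at `2` both halves pass
(precision `2^-20`, `6` Heron steps). -/
example : RBoxBoundClaim.Holds ⟨.add (.inv (.var 0)) (.sqrt (.var 0)), [(1, 4)], 51 / 20⟩ :=
  RBoxBoundClaim.holds_of_check _ (.split 0 2 (.leaf (20, 6)) (.leaf (20, 6))) (by decide +kernel)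

end Literature.Analysis.ValidatedNumerics
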